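import Mathlib
import HarnessLib
import Literature.Analysis.FluidPDE.VorticityCalculus
import Literature.Analysis.FluidPDE.TypeIAncientMildTubeAnalyticity
import Literature.Analysis.FluidPDE.TubeSliceCauchyEstimates
import Literature.Analysis.ODE.CompactSupportFlow
import Summits.NavierStokesRegularity.NavierStokesRegularity.Theorems.LocalSineTubeDoorProfileAlignedWindowRigidityAncient

/-!
# Route `PoloidalWindowDoor`, crux `PoloidalWindowRigidity` (stmt-NavierStokesRegularity-19708) — LINE 18 «leaf_uniform» v1.3 (ns-idea-8 g9): support R15
# `VortexLineGlobal`, VERBATIM (Cruxes-local `Pinned` unfolded)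

Cell ns-regularity-ideate, seat ns-poloidal-K2-p2 g13 (K2 hand).  R15 (v1.2/v1.3, «PROVABLE, M; support»): through every point of `ℝ³` passes a GLOBAL
integral curve of the vorticity `ω(−1,·) = curl v(−1,·)` of a pinned class profile.  Exactly the docstring's route, every step a tree lemma:

* the slice `v(−1,·)` extends holomorphically to a uniform complex tube with a uniform bound — `Literature.Analysis.FluidPDE.exists_tube_extension_of_typeI_ancient_mild`
  (its `C¹`-slice hypothesis from the class analyticity `…Ancient.analyticOnNhd_slice`);
* Cauchy estimates on the tube bound EVERY derivative of the slice uniformly on `ℝ³` — `Literature.Analysis.FluidPDE.norm_iteratedFDeriv_slice_le_of_tube`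
  (`j = 1, 2`): `‖Dv(−1,·)‖ ≤ 4B/r`, `‖D²v(−1,·)‖ ≤ 36B/r²`;
* `curl v = curlCLM ∘ Dv` (`curl_eq_curlCLM`, definitional), so `ω(−1,·)` is BOUNDED (`‖curlCLM‖·4B/r`) and globally LIPSCHITZ (mean value inequality
  `lipschitzWith_of_nnnorm_fderiv_le` for `Dv`, composed with the continuous linear `curlCLM`);
* a bounded globally Lipschitz autonomous field has global integral curves through every point — `Literature.Analysis.ODE.exists_solution_real_of_lipschitz_of_bound`.

HONEST LABEL: one M support of LINE 18; R8/R11/R16–R19 and the research cells are NOT touched; C2a′ / ⟨19708⟩ / ⟨20428⟩ OPEN; NS regularity NOT proved.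
-/

noncomputable section

-- the summit and its single sub-problem share the name (CONVENTIONS §1), as in every Theorems file
set_option linter.dupNamespace false

namespace Summit.NavierStokesRegularity.NavierStokesRegularity.Theorems.PoloidalWindowDoorPoloidalWindowRigidityLeafUniformVortexLine

open Set Function Filter Topology
open scoped InnerProductSpace RealInnerProductSpace Laplacian NNReal
open Literature.Analysis Literature.Analysis.FluidPDE Literature.Analysis.UnboundedOperators
open Summit.NavierStokesRegularity.NavierStokesRegularity.Theorems.LocalSineTubeDoorProfileAlignedWindowRigidityAncient

/-- **Bounded Lipschitz vorticity of a class slice**: for a class profile, `curl v(s,·)` (`s < 0`) is bounded and globally Lipschitz on `ℝ³`. -/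
theorem curl_slice_bounded_lipschitz {C : ℝ} {v : ℝ → EuclideanSpace ℝ (Fin 3) → EuclideanSpace ℝ (Fin 3)}
    (hrate : HasTypeITimeDecay C v) (hcont : ContinuousOn (uncurry v) (Iio (0 : ℝ) ×ˢ univ))
    (hmild : ∀ s t : ℝ, s < t → t < 0 → ∀ x, v t x = heatExtension (v s) (t - s) x - oseenDuhamel 1 s v v t x)
    (hdiv : ∀ t < 0, VectorCalculus.IsDivFree (v t)) {s : ℝ} (hs : s < 0) :
    ∃ (K : ℝ≥0) (L : ℝ), LipschitzWith K (curl (v s)) ∧ ∀ q, ‖curl (v s) q‖ ≤ L := by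
  have hsl : ∀ t < 0, AnalyticOnNhd ℝ (v t) univ := fun t ht =>
    analyticOnNhd_slice hcont (bdd_of_hasTypeITimeDecay hrate) hmild ht
  have hC1 : ∀ t < 0, ContDiff ℝ 1 (v t) := fun t ht => (hsl t ht).contDiff
  obtain ⟨r, hr, B, U, hU, hUf, hB⟩ := exists_tube_extension_of_typeI_ancient_mild hrate hcont hmild hdiv hC1 hs
  have h2 : ContDiff ℝ 2 (v s) := (hsl s hs).contDiff
  -- uniform first- and second-derivative bounds from the tube
  have hD1 : ∀ x, ‖fderiv ℝ (v s) x‖ ≤ B * (2 * ((1 : ℝ) + 1) / r) ^ 1 := fun x => by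
    rw [← norm_iteratedFDeriv_one (𝕜 := ℝ)]
    exact_mod_cast norm_iteratedFDeriv_slice_le_of_tube hr hU hUf hB 1 x
  have hD2 : ∀ x, ‖fderiv ℝ (fderiv ℝ (v s)) x‖ ≤ B * (2 * ((2 : ℝ) + 1) / r) ^ 2 := fun x => by
    rw [← norm_iteratedFDeriv_one (𝕜 := ℝ), norm_iteratedFDeriv_fderiv]
    exact_mod_cast norm_iteratedFDeriv_slice_le_of_tube hr hU hUf hB 2 x
  -- `Dv(s,·)` is globally Lipschitz
  have hdd : Differentiable ℝ (fderiv ℝ (v s)) :=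
    (h2.fderiv_right (m := 1) (by norm_num)).differentiable (by norm_num)
  set K₂ : ℝ≥0 := (B * (2 * ((2 : ℝ) + 1) / r) ^ 2).toNNReal with hK₂
  have hLipD : LipschitzWith K₂ (fderiv ℝ (v s)) := by
    refine lipschitzWith_of_nnnorm_fderiv_le hdd fun x => ?_
    rw [← NNReal.coe_le_coe, coe_nnnorm]
    exact (hD2 x).trans (Real.le_coe_toNNReal _)
  have hLip : LipschitzWith (‖curlCLM‖₊ * K₂) (curl (v s)) := by
    have e : curl (v s) = curlCLM ∘ fderiv ℝ (v s) := rfl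
    rw [e]
    exact curlCLM.lipschitz.comp hLipD
  refine ⟨‖curlCLM‖₊ * K₂, ‖curlCLM‖ * (B * (2 * ((1 : ℝ) + 1) / r) ^ 1), hLip, fun q => ?_⟩
  rw [curl_eq_curlCLM]
  exact (curlCLM.le_opNorm _).trans (mul_le_mul_of_nonneg_left (hD1 q) (norm_nonneg _))

/-- **R15 `VortexLineGlobal` (VERBATIM, `Pinned` unfolded)**: through every point there is a global integral curve of `ω(−1,·)`. -/
theorem vortexLineGlobal :
    ∀ (C : ℝ) (v : ℝ → EuclideanSpace ℝ (Fin 3) → EuclideanSpace ℝ (Fin 3)),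
      (Literature.Analysis.FluidPDE.HasTypeITimeDecay C v ∧
        ContinuousOn (Function.uncurry v) (Set.Iio (0 : ℝ) ×ˢ Set.univ) ∧
        (∀ s t : ℝ, s < t → t < 0 → ∀ x, v t x =
          Literature.Analysis.UnboundedOperators.heatExtension (v s) (t - s) x -
            Literature.Analysis.FluidPDE.oseenDuhamel 1 s v v t x) ∧
        (∀ t < 0, Literature.Analysis.FluidPDE.VectorCalculus.IsDivFree (v t)) ∧
        (∀ s < 0, ∀ y, ⟪Literature.Analysis.FluidPDE.curl (v s) y, EuclideanSpace.single 2 1⟫_ℝ = 0) ∧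
        v (-1) 0 2 ≠ 0 ∧ (∀ t < 0, ∀ x, Real.sqrt (-t) * |v t x 2| ≤ |v (-1) 0 2|) ∧
        (∀ h : EuclideanSpace ℝ (Fin 3), fderiv ℝ (v (-1)) 0 h 2 = 0) ∧
        (deriv (fun s => v s 0 2) (-1) = v (-1) 0 2 / 2 ∧ v (-1) 0 2 * (Δ (fun y => v (-1) y 2)) 0 ≤ 0)) →
      ∀ y : EuclideanSpace ℝ (Fin 3), ∃ γ : ℝ → EuclideanSpace ℝ (Fin 3), γ 0 = y ∧
        ∀ τ : ℝ, HasDerivAt γ (Literature.Analysis.FluidPDE.curl (v (-1)) (γ τ)) τ := by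
  intro C v hP y
  obtain ⟨hrate, hcont, hmild, hdiv, -, -, -, -, -⟩ := hP
  obtain ⟨K, L, hK, hL⟩ := curl_slice_bounded_lipschitz hrate hcont hmild hdiv (by norm_num : (-1 : ℝ) < 0)
  exact Literature.Analysis.ODE.exists_solution_real_of_lipschitz_of_bound hK hL y

end Summit.NavierStokesRegularity.NavierStokesRegularity.Theorems.PoloidalWindowDoorPoloidalWindowRigidityLeafUniformVortexLine

end
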